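import Mathlib
import HarnessLib.Audit
import Summits.PneNP.PneNP.Theorems.PstarSliceGenericCriterion

/-!
# Every centre structure has at least six clean chords; O1 from a bound on the criterion failures (ROUND-24, O1; memo g23 §26)

FRONTIER range-avoidance ladder, rung F-N3, ROUND 24 (cell `pnp-ideate`, prover-2 memo `g23/O1-TWOCLEAN-g23.md` §25–§26; typed target
`PstarCoreBoundTargets.TerminalPeelable` (p646951); restricted-model proof complexity — nothing here bears on `P` versus `NP`).

The arithmetic behind the assembled O1 node `PstarSliceGenericCriterion.TwoCleanCriterion`, for ANY sharing pattern (not only the tight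
`k = 12` structures):

* `card_nonchords_le_card_sharedSlots` — every non-chord owns a shared AND slot: `#nonchords ≤ #sharedSlots`;
* `exists_clean_chords` — **a terminal core has at least `#sharedSlots` CLEAN (outside-gated) chords**: `#chords ≥ #J₀ − #sharedSlots`, and the
  dirty chords number at most the boundary slack `2·#bdry − 3·#J₀ ≤ #J₀ − 2·#sharedSlots` (`PstarChordReadTwoCleanCount.card_dirty_le_slack` with
  `PstarSharingBound.card_bdry_add_card_sharedSlots_le`);  with a centre cycle `#sharedSlots ≥ 6` (`PstarTerminalPeelableTwelve.twelve_le_two_mul_card_sharedSlots`),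
  so there are at least SIX clean chords (`exists_six_clean_chords`);
* `CleanCriterionBound` (OPEN): on every centre structure all but at most `#sharedSlots − 2` clean chords satisfy `NoPathSumSubcore` (branch (A),
  O2-type) and `NoShortCoincidence` (branch (B), finite combinatorics; planner census: at most TWO chords of a tri/c4a structure fail);
  **`twoCleanCriterion_of_bound : CleanCriterionBound → TwoCleanCriterion`** and **`terminalPeelable_of_bound : CleanCriterionBound → TerminalPeelable`**.

No Assumption A.
-/

set_option linter.dupNamespace false -- `Summit.PneNP.PneNP.…`: summit = sub-problem name (D-0017 single-conjunct layout)

open Finset Literature.Computability.Complexity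
open Summit.PneNP.PneNP.Theorems.PstarTyped (Typed)
open Summit.PneNP.PneNP.Theorems.PstarSALevel (varSet bdry BoundaryExpanding SimpleOverlap)
open Summit.PneNP.PneNP.Theorems.PstarSAClosure (degIn mem_bdry_iff)
open Summit.PneNP.PneNP.Theorems.PstarXCore (xverts)
open Summit.PneNP.PneNP.Theorems.PstarCentreFree (vars_mem_varSet)
open Summit.PneNP.PneNP.Theorems.PstarChordRepair (IsChord)
open Summit.PneNP.PneNP.Theorems.PstarCoreBoundTargets (Terminal TerminalPeelable nonchords mem_nonchords)
open Summit.PneNP.PneNP.Theorems.PstarSharingBound (sharedSlots mult card_bdry_add_card_sharedSlots_le)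
open Summit.PneNP.PneNP.Theorems.PstarChordBridgeCentre (mem_sharedSlots)
open Summit.PneNP.PneNP.Theorems.PstarChordBridgeTools (xpdeg)
open Summit.PneNP.PneNP.Theorems.PstarChordReadOutside (OutsideGated)
open Summit.PneNP.PneNP.Theorems.PstarTerminalPeelableTwelve (twelve_le_two_mul_card_sharedSlots)
open Summit.PneNP.PneNP.Theorems.PstarChordReadTwoCleanCount (card_dirty_le_slack)
open Summit.PneNP.PneNP.Theorems.PstarSliceGenericCriterion (NoPathSumSubcore NoShortCoincidence TwoCleanCriterion terminalPeelable_of_criterion)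

namespace Summit.PneNP.PneNP.Theorems.PstarCleanChordCount

variable {n m : ℕ} {I : LocalMap 4 n m} {r : ℕ} {y : Fin m → Bool} {J₀ : Finset (Fin m)} {w₁ w₂ : Finset (Fin n) × Finset (Fin m) × Bool}

/-- A variable of an output of `J₀` off the boundary has multiplicity at least two. -/
theorem two_le_mult_of_not_mem_bdry (I : LocalMap 4 n m) {J₀ : Finset (Fin m)} {f : Fin m} (hf : f ∈ J₀) {v : Fin n} (hv : v ∈ varSet I f)
    (hnb : v ∉ bdry I J₀) : 2 ≤ mult I J₀ v := by
  classical
  have h1 : 1 ≤ mult I J₀ v := card_pos.2 ⟨f, mem_filter.2 ⟨hf, hv⟩⟩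
  have hne : mult I J₀ v ≠ 1 := fun h => hnb ((mem_bdry_iff I J₀ v).2 h)
  unfold PstarSharingBound.mult at h1 hne ⊢
  omega

/-- **Every non-chord owns a shared AND slot**: `#nonchords ≤ #sharedSlots`. -/
theorem card_nonchords_le_card_sharedSlots (I : LocalMap 4 n m) (J₀ : Finset (Fin m)) : (nonchords I J₀).card ≤ (sharedSlots I J₀).card := by
  classical
  refine card_le_card_of_injOn (fun f => if I.vars f 2 ∉ bdry I J₀ then (f, (2 : Fin 4)) else (f, 3)) (fun f hf => ?_)
    (fun f _ f' _ h => ?_)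
  · dsimp only
    obtain ⟨hfJ, hnc⟩ := (mem_nonchords I).1 (mem_coe.1 hf)
    unfold PstarChordRepair.IsChord at hnc
    by_cases h2 : I.vars f 2 ∉ bdry I J₀
    · rw [if_pos h2]
      exact mem_coe.2 (mem_sharedSlots.2 ⟨hfJ, (by decide : 2 ≤ (2 : Fin 4).val), two_le_mult_of_not_mem_bdry I hfJ (vars_mem_varSet I f 2) h2⟩)
    · rw [if_neg h2]
      have h3 : I.vars f 3 ∉ bdry I J₀ := fun h3 => hnc ⟨not_not.1 h2, h3⟩
      exact mem_coe.2 (mem_sharedSlots.2 ⟨hfJ, (by decide : 2 ≤ (3 : Fin 4).val), two_le_mult_of_not_mem_bdry I hfJ (vars_mem_varSet I f 3) h3⟩)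
  · dsimp only at h
    have key : ∀ g : Fin m, (if I.vars g 2 ∉ bdry I J₀ then (g, (2 : Fin 4)) else (g, 3)).1 = g := fun g => by split_ifs <;> rfl
    rw [← key f, ← key f', h]

/-- **A terminal core has at least `#sharedSlots` clean chords.** -/
theorem exists_clean_chords (hB : BoundaryExpanding r I) (ht : Terminal I r y J₀ w₁ w₂) :
    ∃ 𝒞 ⊆ J₀, (∀ c ∈ 𝒞, IsChord I J₀ c) ∧ (∀ c ∈ 𝒞, OutsideGated I J₀ (w₁.2.1 ∪ w₂.2.1) c) ∧ (sharedSlots I J₀).card ≤ 𝒞.card := by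
  classical
  set Ch := J₀.filter fun c => IsChord I J₀ c with hCh
  set 𝒟 := Ch.filter fun c => ¬ OutsideGated I J₀ (w₁.2.1 ∪ w₂.2.1) c with h𝒟
  set 𝒞 := Ch.filter fun c => OutsideGated I J₀ (w₁.2.1 ∪ w₂.2.1) c with h𝒞
  have hChJ : Ch ⊆ J₀ := filter_subset _ _
  -- chords + non-chords = all
  have hsplit : Ch.card + (nonchords I J₀).card = J₀.card := by
    have h := card_filter_add_card_filter_not (s := J₀) (fun c => IsChord I J₀ c)
    have e : (J₀.filter fun c => ¬ IsChord I J₀ c) = nonchords I J₀ := by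
      ext f; rw [mem_filter, mem_nonchords]
    rw [e] at h
    exact h
  have hCD : 𝒞.card + 𝒟.card = Ch.card := card_filter_add_card_filter_not _
  -- dirty chords are paid by the slack
  have hexp := hB J₀ ht.2.2.1.le
  have hslot := card_bdry_add_card_sharedSlots_le I J₀ ht.2.1
  have hD : 𝒟.card ≤ 2 * (bdry I J₀).card - 3 * J₀.card :=
    card_dirty_le_slack hB ht (t := 2 * (bdry I J₀).card - 3 * J₀.card) (by omega) ((filter_subset _ Ch).trans hChJ)
      (fun c hc => (mem_filter.1 (mem_filter.1 hc).1).2) (fun c hc => (mem_filter.1 hc).2)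
  have hN := card_nonchords_le_card_sharedSlots I J₀
  refine ⟨𝒞, (filter_subset _ Ch).trans hChJ, fun c hc => (mem_filter.1 (mem_filter.1 hc).1).2, fun c hc => (mem_filter.1 hc).2, ?_⟩
  omega

/-- **A terminal core with a centre cycle has at least six clean chords.** -/
theorem exists_six_clean_chords (hI : I.IsPure xorAndPred) (hT : Typed I) (hS : SimpleOverlap I) (hB : BoundaryExpanding r I)
    (ht : Terminal I r y J₀ w₁ w₂) (hS₀ : ∃ S ⊆ J₀, S.Nonempty ∧ (∀ w ∈ xverts I S, 2 ≤ xpdeg I S w) ∧ ∀ f ∈ S, ¬ IsChord I J₀ f) :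
    ∃ 𝒞 ⊆ J₀, (∀ c ∈ 𝒞, IsChord I J₀ c) ∧ (∀ c ∈ 𝒞, OutsideGated I J₀ (w₁.2.1 ∪ w₂.2.1) c) ∧ 6 ≤ 𝒞.card := by
  obtain ⟨S, hSJ, hne, hL, hnc⟩ := hS₀
  have h12 := twelve_le_two_mul_card_sharedSlots I hI hT hS hB ht.2.2.1.le hSJ hne hL hnc
  obtain ⟨𝒞, h𝒞J, hch, hO, hcard⟩ := exists_clean_chords hB ht
  exact ⟨𝒞, h𝒞J, hch, hO, by omega⟩

/-! ## O1 from a bound on the criterion failures -/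

/-- **`CleanCriterionBound` (OPEN): on every centre structure, all but at most `#sharedSlots − 2` clean chords pass the criterion.**  For every
pure typed `(r,3/2)`-expanding instance with simple overlaps and every terminal core carrying a non-empty leafless set of non-chords there is a set
`ℬ ⊆ J₀` with `#ℬ + 2 ≤ #sharedSlots J₀` such that every outside-gated chord of `J₀` outside `ℬ` satisfies `NoPathSumSubcore` (branch (A), O2-type)
and `NoShortCoincidence` (branch (B), finite combinatorics) for the menu `G₁ ∪ G₂`.  FRONTIER. -/
@[conjecture] def CleanCriterionBound : Prop :=
  ∀ (n m r : ℕ) (I : LocalMap 4 n m), I.IsPure xorAndPred → Typed I → SimpleOverlap I → BoundaryExpanding r I →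
    ∀ (y : Fin m → Bool) (J₀ : Finset (Fin m)) (w₁ w₂ : Finset (Fin n) × Finset (Fin m) × Bool), Terminal I r y J₀ w₁ w₂ →
      (∃ S ⊆ J₀, S.Nonempty ∧ (∀ w ∈ xverts I S, 2 ≤ xpdeg I S w) ∧ ∀ f ∈ S, ¬ IsChord I J₀ f) →
      ∃ ℬ ⊆ J₀, ℬ.card + 2 ≤ (sharedSlots I J₀).card ∧
        ∀ c ∈ J₀, c ∉ ℬ → IsChord I J₀ c → OutsideGated I J₀ (w₁.2.1 ∪ w₂.2.1) c →
          NoPathSumSubcore I r y J₀ c (w₁.2.1 ∪ w₂.2.1) ∧ NoShortCoincidence I J₀ c (w₁.2.1 ∪ w₂.2.1)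

/-- **The failure bound gives two clean chords passing the criterion.** -/
theorem twoCleanCriterion_of_bound (h : CleanCriterionBound) : TwoCleanCriterion := by
  classical
  intro n m r I hI hT hS hB y J₀ w₁ w₂ ht hS₀
  obtain ⟨ℬ, -, hℬ, hgood⟩ := h n m r I hI hT hS hB y J₀ w₁ w₂ ht hS₀
  obtain ⟨𝒞, h𝒞J, hch, hO, hcard⟩ := exists_clean_chords hB ht
  have hU : 1 < (𝒞 \ ℬ).card := by
    have := le_card_sdiff ℬ 𝒞
    omega
  obtain ⟨a, ha, b, hb, hab⟩ := one_lt_card.1 hU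
  obtain ⟨ha𝒞, haℬ⟩ := mem_sdiff.1 ha
  obtain ⟨hb𝒞, hbℬ⟩ := mem_sdiff.1 hb
  obtain ⟨hAa, hBa⟩ := hgood a (h𝒞J ha𝒞) haℬ (hch a ha𝒞) (hO a ha𝒞)
  obtain ⟨hAb, hBb⟩ := hgood b (h𝒞J hb𝒞) hbℬ (hch b hb𝒞) (hO b hb𝒞)
  exact ⟨a, h𝒞J ha𝒞, b, h𝒞J hb𝒞, hab, hch a ha𝒞, hch b hb𝒞, hO a ha𝒞, hO b hb𝒞, hAa, hBa, hAb, hBb⟩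

/-- **O1 FROM THE FAILURE BOUND.** -/
theorem terminalPeelable_of_bound (h : CleanCriterionBound) : TerminalPeelable :=
  terminalPeelable_of_criterion (twoCleanCriterion_of_bound h)

end Summit.PneNP.PneNP.Theorems.PstarCleanChordCount
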